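import Literature.NumberTheory.Transcendental.NesterenkoElimination
import Literature.NumberTheory.Transcendental.RoyCriterion
import Literature.NumberTheory.Transcendental.ChudnovskyHeights
import Literature.Barriers.Schanuel.NesterenkoModularScopeMeasurePolys
import Mathlib.Analysis.SpecialFunctions.Log.Basic
import HarnessLib

/-!
# Philippon's criterion over Nesterenko's toolkit, I: the point `ω̄ = (1, θ)` and homogenisation of integer polynomials — proofs only

`Literature/NumberTheory/Transcendental/PhilipponCriterionHomogenization.lean` — proofs only (no new
definitions, nothing asserted). First glue layer of the programme that derives the named fact
`Philippon1986_mainCriterion` (`PhilipponCriterion.lean`: Philippon, Publ. Math. IHÉS 64 (1986),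
Thm 2.11, case `K = ℚ`, `v = ∞`, in Diaz's transcendence-degree form) from Nesterenko's
diophantine estimates for homogeneous ideals of `ℚ[x₀, …, x_n]` (LNM 1752 Ch. 3 §4;
`NesterenkoElimination.lean`, `NesterenkoEliminationFacts.lean`).

Philippon's proof (§3, p. 41) passes from the affine data of the criterion — a point `θ ∈ ℂⁿ` and
integer polynomials `Q ∈ ℤ[X₁, …, X_n]` — to the projective setting by `θ ↦ (1 : θ₁ : … : θ_n)` and
`Q ↦ ʰQ(x₀, …, x_n) = x₀^{deg Q} Q(x₁/x₀, …, x_n/x₀)`. This file provides exactly that passage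
for Nesterenko's invariants:

* the point `ω̄ = (1, θ)` (`Fin.cons 1 θ`): non-zero, `|ω̄| ≥ 1`, `|ω̄| ≥ |θᵢ|`;
* homogeneous polynomials under scaling of the argument (`aeval_smul_of_isHomogeneous`), and
  membership of a homogeneous polynomial in the cone ideal `𝔭_ω̄` of a point
  (`mem_coneIdeal_iff_of_isHomogeneous`: iff it vanishes at `ω̄`);
* `exists_homogenization`: for `Q ∈ ℤ[X₁, …, X_n]` a homogeneous `E ∈ ℚ[x₀, …, x_n]` of degree
  `deg Q` with the same coefficients: `E(1, z) = Q(z)`, `|E| = H(Q)` (maximum modulus of the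
  coefficients), `h(E) ≤ log H(Q) ≤ log L(Q)` (`L` the `ℓ¹`-norm `Chudnovsky.l1` used in
  `Philippon1986_mainCriterion`), `E ≠ 0` if `Q ≠ 0`, and then `‖E‖_ω̄ ≤ |Q(θ)|`
  (`normAt_le_of_homogenization`) and `E ∈ 𝔭_ω̄ ↔ Q(θ) = 0`. (This generalises
  `Literature.Barriers.Schanuel.exists_homogenization`, the case `n = 4` of LNM 1752 Ch. 3 §5, whose
  bookkeeping lemmas `logHeight_intCast_le`, `norm_intCast_rat`, `degree_cons` are reused.)

## References

* [Philippon1986Criteres] P. Philippon, *Critères pour l'indépendance algébrique*, Publ. Math.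
  IHÉS 64 (1986), §3, p. 41 (the homogenisation `ʰP`, the point `(1, θ₁, …, θ_n)`).
* [NesterenkoPhilippon2001] LNM 1752 (2001), Ch. 3 §4 (the invariants), §5 p. 44 (the same
  homogenisation `E = x₀ⁿ B(x₁/x₀, …)`, `H(E) = H(B)`).
-/

noncomputable section

open MvPolynomial Finset
open Literature.NumberTheory.Transcendental.Nesterenko
open Literature.NumberTheory.Transcendental.Chudnovsky
open Literature.Barriers.Schanuel (logHeight_intCast_le norm_intCast_rat degree_cons)

namespace Literature.NumberTheory.Transcendental

namespace PhilipponMain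

variable {n : ℕ}

/-! ### The point `ω̄ = (1, θ)` -/

/-- `ω̄₀ = 1`. [folklore] -/
@[simp] theorem cons_one_zero (θ : Fin n → ℂ) : (Fin.cons 1 θ : Fin (n + 1) → ℂ) 0 = 1 := rfl

/-- `ω̄_{i+1} = θᵢ`. [folklore] -/
@[simp] theorem cons_one_succ (θ : Fin n → ℂ) (i : Fin n) :
    (Fin.cons 1 θ : Fin (n + 1) → ℂ) i.succ = θ i := by
  simp

/-- `ω̄ ≠ 0`. [folklore] -/
theorem cons_one_ne_zero (θ : Fin n → ℂ) : (Fin.cons 1 θ : Fin (n + 1) → ℂ) ≠ 0 := fun h => by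
  simpa using congrFun h 0

/-- `|ω̄| ≥ 1` (sup norm). [folklore] -/
theorem one_le_norm_cons_one (θ : Fin n → ℂ) : 1 ≤ ‖(Fin.cons 1 θ : Fin (n + 1) → ℂ)‖ := by
  have h := norm_le_pi_norm (Fin.cons 1 θ : Fin (n + 1) → ℂ) 0
  rwa [cons_one_zero, norm_one] at h

/-- `|θᵢ| ≤ |ω̄|`. [folklore] -/
theorem norm_le_norm_cons_one (θ : Fin n → ℂ) (i : Fin n) :
    ‖θ i‖ ≤ ‖(Fin.cons 1 θ : Fin (n + 1) → ℂ)‖ := by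
  have h := norm_le_pi_norm (Fin.cons 1 θ : Fin (n + 1) → ℂ) i.succ
  rwa [cons_one_succ] at h

/-- The tail of `ω̄ = (1, θ)` is `θ`. [folklore] -/
theorem tail_cons_one (θ : Fin n → ℂ) : (fun i : Fin n => (Fin.cons 1 θ : Fin (n + 1) → ℂ) i.succ) = θ := by
  funext i; simp

/-! ### Homogeneous polynomials: scaling the argument, membership in `𝔭_ω̄` -/

/-- `E(c • ω) = c^{d} E(ω)` for `E` homogeneous of degree `d`. [folklore] -/
theorem aeval_smul_of_isHomogeneous {E : Rx n} {d : ℕ} (hE : E.IsHomogeneous d) (c : ℂ)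
    (ω : Fin (n + 1) → ℂ) : aeval (c • ω) E = c ^ d * aeval ω E := by
  classical
  conv_lhs => rw [E.as_sum]
  conv_rhs => rw [E.as_sum]
  rw [map_sum, map_sum, Finset.mul_sum]
  refine Finset.sum_congr rfl fun e he => ?_
  have hdeg : ∑ i ∈ e.support, e i = d := by
    have := hE (mem_support_iff.mp he)
    simpa [Finsupp.weight_apply, Finsupp.sum] using this
  rw [aeval_monomial, aeval_monomial]
  simp only [Finsupp.prod, Pi.smul_apply, smul_eq_mul, mul_pow, Finset.prod_mul_distrib,
    Finset.prod_pow_eq_pow_sum, hdeg]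
  ring

/-- A homogeneous polynomial lies in the cone ideal `𝔭_ω̄` of the point `ω̄` iff it vanishes at
`ω̄` (a homogeneous `E` of degree `d` is its own degree-`d` component and has no others:
Mathlib's `MvPolynomial.homogeneousComponent_of_mem`). [folklore] -/
theorem mem_coneIdeal_iff_of_isHomogeneous {E : Rx n} {d : ℕ} (hE : E.IsHomogeneous d)
    (ω : Fin (n + 1) → ℂ) : E ∈ coneIdeal ω ↔ aeval ω E = 0 := by
  rw [mem_coneIdeal_iff]
  constructor
  · intro h
    have := h d
    rwa [homogeneousComponent_of_mem hE, if_pos rfl] at this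
  · intro h k
    rw [homogeneousComponent_of_mem hE]
    split_ifs
    · exact h
    · exact map_zero _

/-- A homogeneous polynomial vanishing at `ω` vanishes at every multiple `c • ω`. [folklore] -/
theorem aeval_smul_eq_zero_of_isHomogeneous {E : Rx n} {d : ℕ} (hE : E.IsHomogeneous d)
    {ω : Fin (n + 1) → ℂ} (h : aeval ω E = 0) (c : ℂ) : aeval (c • ω) E = 0 := by
  rw [aeval_smul_of_isHomogeneous hE, h, mul_zero]

/-! ### Homogenisation of an integer polynomial -/

/-- The naive height `H(Q)` (maximum modulus of the coefficients) is at least `1` for `Q ≠ 0`.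
[folklore] -/
theorem one_le_mvPolyHeight {σ : Type*} {Q : MvPolynomial σ ℤ} (hQ : Q ≠ 0) : 1 ≤ mvPolyHeight Q := by
  obtain ⟨m, hm⟩ := MvPolynomial.ne_zero_iff.mp hQ
  exact Nat.succ_le_of_lt (lt_of_lt_of_le (Int.natAbs_pos.mpr hm) (natAbs_coeff_le_mvPolyHeight Q m))

/-- `H(Q) ≤ L(Q)`: the largest coefficient is at most the `ℓ¹`-norm. [folklore] -/
theorem mvPolyHeight_le_l1 {σ : Type*} (Q : MvPolynomial σ ℤ) : (mvPolyHeight Q : ℝ) ≤ l1 Q := by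
  classical
  by_cases hQ : Q = 0
  · subst hQ; simp
  obtain ⟨d₀, -, hmax⟩ := Finset.exists_mem_eq_sup Q.support (support_nonempty.mpr hQ)
    (fun m => (Q.coeff m).natAbs)
  have h := le_wnorm (normRingSeminorm ℤ) Q d₀
  have h' : (normRingSeminorm ℤ) (Q.coeff d₀) = ((Q.coeff d₀).natAbs : ℝ) := by
    show ‖Q.coeff d₀‖ = _
    rw [Int.norm_eq_abs, ← Int.cast_abs, Int.abs_eq_natAbs, Int.cast_natCast]
  rw [mvPolyHeight, hmax]
  rwa [h'] at h

/-- `log H(Q) ≤ log L(Q)` for `Q ≠ 0`. [folklore] -/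
theorem log_mvPolyHeight_le_log_l1 {σ : Type*} {Q : MvPolynomial σ ℤ} (hQ : Q ≠ 0) :
    Real.log (mvPolyHeight Q) ≤ Real.log (l1 Q) :=
  Real.log_le_log (by exact_mod_cast one_le_mvPolyHeight hQ) (mvPolyHeight_le_l1 Q)

/-- **Homogenisation** `ʰQ(x₀, …, x_n) = x₀^{deg Q} Q(x₁/x₀, …, x_n/x₀)` (Philippon 1986, §3, p. 41;
LNM 1752 Ch. 3 §5, p. 44): for `Q ∈ ℤ[X₁, …, X_n]` there is a homogeneous `E ∈ ℚ[x₀, …, x_n]` of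
degree `deg Q` (total degree) with the same coefficients — so `|E| = H(Q)`, `h(E) ≤ log H(Q)` —
taking the value `Q(ω₁, …, ω_n)` at every `ω̄` with `ω₀ = 1`, and non-zero if `Q ≠ 0`.
[cite: Philippon1986Criteres, §3 p. 41 (ʰP)] -/
theorem exists_homogenization (Q : MvPolynomial (Fin n) ℤ) :
    ∃ E : Rx n, E.IsHomogeneous Q.totalDegree ∧
      (∀ ω : Fin (n + 1) → ℂ, ω 0 = 1 → aeval ω E = aeval (fun i : Fin n => ω i.succ) Q) ∧
      maxNorm E = (mvPolyHeight Q : ℝ) ∧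
      height E ≤ Real.log (mvPolyHeight Q) ∧
      (Q ≠ 0 → E ≠ 0) := by
  classical
  set N := Q.totalDegree with hN
  -- the exponent vectors of `E`
  let lift : (Fin n →₀ ℕ) → (Fin (n + 1) →₀ ℕ) := fun d => Finsupp.cons (N - d.degree) d
  have hlift_inj : ∀ d d', lift d = lift d' → d = d' := fun d d' h => by
    have := congrArg Finsupp.tail h
    simpa [lift, Finsupp.tail_cons] using this
  have htail : ∀ d, Finsupp.tail (lift d) = d := fun d => by simp [lift, Finsupp.tail_cons]
  have hdeg : ∀ d ∈ Q.support, (lift d).degree = N := fun d hd => by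
    have h1 : d.degree ≤ N := le_totalDegree hd
    rw [degree_cons]
    omega
  let E : Rx n := ∑ d ∈ Q.support, monomial (lift d) ((Q.coeff d : ℤ) : ℚ)
  -- coefficients of `E`
  have hcoeff : ∀ e, coeff e E = ∑ d ∈ Q.support, if lift d = e then ((Q.coeff d : ℤ) : ℚ) else 0 := by
    intro e
    simp only [E, coeff_sum, coeff_monomial]
  have hcoeff_lift : ∀ d ∈ Q.support, coeff (lift d) E = ((Q.coeff d : ℤ) : ℚ) := by
    intro d hd
    rw [hcoeff, Finset.sum_eq_single d]
    · rw [if_pos rfl]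
    · intro d' _ hne
      rw [if_neg]
      exact fun h => hne (hlift_inj _ _ h)
    · exact fun h => absurd hd h
  have hcoeff_of_ne : ∀ e, coeff e E ≠ 0 → ∃ d ∈ Q.support, lift d = e := by
    intro e he
    rw [hcoeff] at he
    obtain ⟨d, hd, hne⟩ := Finset.exists_ne_zero_of_sum_ne_zero he
    refine ⟨d, hd, ?_⟩
    by_contra h
    rw [if_neg h] at hne
    exact hne rfl
  have hcoeff_mem : ∀ e ∈ E.support,
      ∃ d ∈ Q.support, lift d = e ∧ coeff e E = ((Q.coeff d : ℤ) : ℚ) := by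
    intro e he
    obtain ⟨d, hd, rfl⟩ := hcoeff_of_ne e (mem_support_iff.mp he)
    exact ⟨d, hd, rfl, hcoeff_lift d hd⟩
  refine ⟨E, ?_, ?_, ?_, ?_, ?_⟩
  · -- homogeneous of degree `N`
    refine IsHomogeneous.sum Q.support (fun d => monomial (lift d) ((Q.coeff d : ℤ) : ℚ)) N ?_
    intro d hd
    exact isHomogeneous_monomial _ (hdeg d hd)
  · -- the value at `ω̄` with `ω₀ = 1`
    intro ω hω
    rw [map_sum]
    conv_rhs => rw [MvPolynomial.aeval_def, eval₂_eq']
    refine Finset.sum_congr rfl fun d hd => ?_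
    rw [aeval_monomial, Finsupp.prod_fintype _ _ (fun i => by simp), Fin.prod_univ_succ]
    simp [lift, Finsupp.cons_zero, Finsupp.cons_succ, hω]
  · -- `|E| = H(Q)`
    apply le_antisymm
    · rw [maxNorm]
      have : (E.support.sup fun γ => ‖E.coeff γ‖₊) ≤ (mvPolyHeight Q : NNReal) := by
        refine Finset.sup_le fun e he => ?_
        obtain ⟨d, hd, -, hc⟩ := hcoeff_mem e he
        rw [hc]
        have h1 := natAbs_coeff_le_mvPolyHeight Q d
        rw [← NNReal.coe_le_coe, coe_nnnorm, NNReal.coe_natCast, norm_intCast_rat]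
        exact_mod_cast h1
      exact_mod_cast this
    · by_cases hQ : Q = 0
      · have : mvPolyHeight Q = 0 := by rw [hQ, mvPolyHeight_zero]
        rw [this, Nat.cast_zero]
        exact maxNorm_nonneg _
      obtain ⟨d₀, hd₀, hmax⟩ := Finset.exists_mem_eq_sup Q.support
        (support_nonempty.mpr hQ) (fun m => (Q.coeff m).natAbs)
      have h1 : (mvPolyHeight Q : ℝ) = ‖coeff (lift d₀) E‖ := by
        rw [hcoeff_lift d₀ hd₀, mvPolyHeight, hmax, norm_intCast_rat]
      rw [h1]
      exact norm_coeff_le_maxNorm E _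
  · -- `h(E) ≤ log H(Q)`
    by_cases hQ : Q = 0
    · have hE : E = 0 := by simp [E, hQ]
      rw [hE, hQ, mvPolyHeight_zero, Nat.cast_zero, Real.log_zero, height]
      have : (fun γ : (0 : Rx n).support => (0 : Rx n).coeff γ) = 0 := by
        funext γ; simp
      rw [this, Height.logHeight_zero]
    rw [height]
    have hfun : (fun γ : E.support => E.coeff γ) =
        fun γ : E.support => ((Q.coeff (Finsupp.tail γ.1) : ℤ) : ℚ) := by
      funext γ
      obtain ⟨d, hd, hde, hc⟩ := hcoeff_mem γ.1 γ.2
      rw [hc, ← hde, htail]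
    rw [hfun]
    exact logHeight_intCast_le (fun γ : E.support => Q.coeff (Finsupp.tail γ.1))
      (one_le_mvPolyHeight hQ) (fun γ => natAbs_coeff_le_mvPolyHeight Q _)
  · -- `Q ≠ 0 ⇒ E ≠ 0`
    intro hQ
    obtain ⟨d₀, hd₀⟩ := MvPolynomial.ne_zero_iff.mp hQ
    intro h
    have := hcoeff_lift d₀ (mem_support_iff.mpr hd₀)
    rw [h, coeff_zero] at this
    exact hd₀ (by exact_mod_cast this.symm)

/-! ### Consequences for a homogenisation `E` of `Q` at the point `ω̄ = (1, θ)` -/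

section Consequences

variable {Q : MvPolynomial (Fin n) ℤ} {E : Rx n}

/-- `E(1, z) = Q(z)`. [folklore] -/
theorem aeval_cons_one_of_homogenization
    (hval : ∀ ω : Fin (n + 1) → ℂ, ω 0 = 1 → aeval ω E = aeval (fun i : Fin n => ω i.succ) Q)
    (z : Fin n → ℂ) : aeval (Fin.cons 1 z : Fin (n + 1) → ℂ) E = aeval z Q := by
  rw [hval _ (cons_one_zero z), tail_cons_one]

/-- `E(y) = 0 ↔ Q(y₁/y₀, …, y_n/y₀) = 0` for `y₀ ≠ 0` and `E` homogeneous. [folklore] -/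
theorem aeval_eq_zero_iff_of_homogenization {d : ℕ} (hE : E.IsHomogeneous d)
    (hval : ∀ ω : Fin (n + 1) → ℂ, ω 0 = 1 → aeval ω E = aeval (fun i : Fin n => ω i.succ) Q)
    {y : Fin (n + 1) → ℂ} (hy : y 0 ≠ 0) :
    aeval y E = 0 ↔ aeval (fun i : Fin n => y i.succ / y 0) Q = 0 := by
  have hscale : y = y 0 • ((y 0)⁻¹ • y) := by
    rw [smul_smul, mul_inv_cancel₀ hy, one_smul]
  have h1 : aeval y E = y 0 ^ d * aeval ((y 0)⁻¹ • y) E := by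
    conv_lhs => rw [hscale]
    exact aeval_smul_of_isHomogeneous hE _ _
  have h2 : aeval ((y 0)⁻¹ • y) E = aeval (fun i : Fin n => y i.succ / y 0) Q := by
    rw [hval _ (by simp [hy])]
    have hfun : (fun i : Fin n => ((y 0)⁻¹ • y) i.succ) = fun i => y i.succ / y 0 := by
      funext i
      simp [div_eq_inv_mul]
    rw [hfun]
  rw [h1, h2, mul_eq_zero, or_iff_right (pow_ne_zero _ hy)]

/-- `‖E‖_ω̄ ≤ |Q(θ)|` at `ω̄ = (1, θ)` when `Q ≠ 0` (then `|E| = H(Q) ≥ 1`, and `|ω̄| ≥ 1`).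
[folklore] -/
theorem normAt_le_of_homogenization (hQ : Q ≠ 0)
    (hval : ∀ ω : Fin (n + 1) → ℂ, ω 0 = 1 → aeval ω E = aeval (fun i : Fin n => ω i.succ) Q)
    (hmax : maxNorm E = (mvPolyHeight Q : ℝ)) (θ : Fin n → ℂ) :
    normAt (Fin.cons 1 θ) E ≤ ‖aeval θ Q‖ := by
  rw [normAt, aeval_cons_one_of_homogenization hval]
  refine div_le_self (norm_nonneg _) ?_
  refine one_le_mul_of_one_le_of_one_le ?_ (one_le_pow₀ (one_le_norm_cons_one θ))
  rw [hmax]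
  exact_mod_cast one_le_mvPolyHeight hQ

/-- `‖E‖_ω̄ ≤ exp(−S)` as soon as `|Q(θ)| ≤ exp(−S)` (`Q ≠ 0`). [folklore] -/
theorem normAt_le_exp_of_homogenization (hQ : Q ≠ 0)
    (hval : ∀ ω : Fin (n + 1) → ℂ, ω 0 = 1 → aeval ω E = aeval (fun i : Fin n => ω i.succ) Q)
    (hmax : maxNorm E = (mvPolyHeight Q : ℝ)) {θ : Fin n → ℂ} {S : ℝ}
    (hsmall : ‖aeval θ Q‖ ≤ Real.exp (-S)) : normAt (Fin.cons 1 θ) E ≤ Real.exp (-S) :=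
  (normAt_le_of_homogenization hQ hval hmax θ).trans hsmall

/-- `h(E) ≤ log L(Q)` (`Q ≠ 0`): the height hypothesis `log L(Q) ≤ σ(N)` of
`Philippon1986_mainCriterion` bounds Nesterenko's height of the homogenisation. [folklore] -/
theorem height_le_log_l1_of_homogenization (hQ : Q ≠ 0)
    (hh : height E ≤ Real.log (mvPolyHeight Q)) : height E ≤ Real.log (l1 Q) :=
  hh.trans (log_mvPolyHeight_le_log_l1 hQ)

/-- `E ∈ 𝔭_ω̄ ↔ Q(θ) = 0` for the cone ideal of `ω̄ = (1, θ)`. [folklore] -/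
theorem mem_coneIdeal_iff_of_homogenization {d : ℕ} (hE : E.IsHomogeneous d)
    (hval : ∀ ω : Fin (n + 1) → ℂ, ω 0 = 1 → aeval ω E = aeval (fun i : Fin n => ω i.succ) Q)
    (θ : Fin n → ℂ) : E ∈ coneIdeal (Fin.cons 1 θ : Fin (n + 1) → ℂ) ↔ aeval θ Q = 0 := by
  rw [mem_coneIdeal_iff_of_isHomogeneous hE, aeval_cons_one_of_homogenization hval]

/-- If every element of an ideal `𝔓 ⊆ 𝔭_ω̄` vanishes at `ω̄ = (1, θ)` in the sense of the cone
ideal and `Q(θ) ≠ 0`, then `E ∉ 𝔓`. [folklore] -/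
theorem not_mem_of_le_coneIdeal {d : ℕ} (hE : E.IsHomogeneous d)
    (hval : ∀ ω : Fin (n + 1) → ℂ, ω 0 = 1 → aeval ω E = aeval (fun i : Fin n => ω i.succ) Q)
    {θ : Fin n → ℂ} {𝔓 : Ideal (Rx n)} (h𝔓 : 𝔓 ≤ coneIdeal (Fin.cons 1 θ : Fin (n + 1) → ℂ))
    (hQθ : aeval θ Q ≠ 0) : E ∉ 𝔓 := fun h =>
  hQθ ((mem_coneIdeal_iff_of_homogenization hE hval θ).mp (h𝔓 h))

end Consequences

end PhilipponMain

end Literature.NumberTheory.Transcendental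

end
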